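import Literature.MathematicalPhysics.QuantumFieldTheory.Balaban1983to89.B1Eq369Model
import Literature.MathematicalPhysics.QuantumFieldTheory.Balaban1983to89.B1Ineq358TreeDecaySum
import Literature.MathematicalPhysics.QuantumFieldTheory.Balaban1983to89.B1Ineq352LevelK
import Literature.MathematicalPhysics.QuantumFieldTheory.Balaban1983to89.B1Ineq352Proof

/-!
# `Balaban1983to89.B1Prop32InteractionBound` — T. Bałaban, *(Higgs)₂,₃ quantum fields in a finite volume. I. A lower bound*,
Commun. Math. Phys. **85** (1982) 603–626 [Balaban1982Higgs1]: the sentence of p. 625 [PDF 23] following (3.66) — *"Using representation (3.57)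
in Proposition 3.2 and the restrictions on the fields A, φ we can estimate the absolute value of the interaction V^{(K)ε} by O(1)(L^Kε)^{κ₀}|T₁^{(K)}|"*
— PROVED FOR THE CONCRETE (Higgs)₂,₃ MODEL from the printed data of Proposition 3.2 at `k = K` (the representation (3.57) with the kernel
bounds (3.58), displayed as the hypothesis it is in paper I), with the `O(1)` EXPLICIT and ε-INDEPENDENT under the stopping rule of p. 624;
whence the displayed input (E2) `hE2` — *"|V^{(K),ε}| ≦ C₂|T_ε|"* — of the model's ledger of the lower bound (1.14) (`B1Eq369Model.PreInputs369`)
is DISCHARGED in favour of the printed (3.57)/(3.58)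

statement-level skeleton of published theorems with citation tags; proofs where landed; nothing here is a claim about the Yang–Mills mass gap

PDF held: `paper:balaban1982-cmp85-higgs23-i` (journal page = PDF page + 602); p. 622 [PDF 20] (Prop. 3.2), p. 624 [PDF 22] ((3.66), the stopping
rule), p. 625 [PDF 23], p. 607 [PDF 5] ((1.21)–(1.22)) READ AS IMAGES on the ×2 renders
`run/shared/lean/pub/pub-balaban/b2b-balaban-ref1/pages/1982-cmp85-higgs23-I/1982-cmp85-higgs23-I-p0{05,20,22,23}-x2.png`.

CITATION HEADER (lean-in-tree rule).  Cell `lit-balaban` (HOME `run/shared/lean/pub/lit-balaban/`), Phase-2 proof seat **p14** gen 12 (unit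
`lit-balaban-p14`; TAKING line HOME/STATUS.md 2026-08-21T22:39Z), file 3 of 3.  SKELETON rows **B1.Prop3.2** (owner r01/r12; typed carrier-abstract by
r14, `B1LowerBound.Prop32Printed` — untouched), **B1.Eq3.66–3.67** (owner r12) and **B1.Thm@606** (the model ledger: `B1LowerBound114Model.Inputs`
gen 7 → `B1Ineq368QuadForms.PreInputs` / `B1Eq369Model.PreInputs369` gen 11, fields `hQ`, `h369` discharged; THIS FILE discharges `hE2`).  USED BY
NAME, never restated: file 1 `B1Ineq358TreeDecaySum.{diam, poly357, polyConst, abs_poly357_le, polyConst_nonneg}` (tree-decay summation on `T^{(K)}`),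
file 2 `B1Ineq352LevelK.unit_field_bounds_of_chiW_ne_zero` (*"the restrictions on the fields A, φ"*), `B1Eq369Model.{PreInputs369, card_site_eq_vol,
lowerBound_lattice_of_preInputs369, cutoffFamilyStop, HasStop}`, `B1LowerBound114Model.{Consts, mesh_gt_of_stop, volT_nonneg}`, `B1Ineq352Proof.pFn_anti`.

WHAT IS PRINTED (verbatim).  p. 622 [PDF 20]: *"**Proposition 3.2.** The function V^{(k)}(B^{(k+1)},ψ,A′^{(k)},φ′) has the form V^{(k)}(…) =
Σ_{n,m=0}^{n(n̄)} Σ_{x₁,…,x_n,y₁,…,y_m∈T₁^{(k)}} Σ_{j₁,…,j_n=1}^{N} Σ_{μ₁,…,μ_m=1}^{d} v^{(k)}_{j₁,…,j_n;μ₁,…,μ_m}(B^{(k+1)},ψ;x₁,…,x_n,y₁,…,y_m)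
φ′_{j₁}(x₁)…φ′_{j_n}(x_n)A′_{μ₁}(y₁)…A′_{μ_m}(y_m), (3.57) and the coefficients in the above representation satisfy the inequalities |v^{(k)}_{…}(…)| ≦
O(1)(L^kε)^{κ₀}exp(−δ₀d(x₁,…,x_n,y₁,…,y_m)) (3.58) for some independent of k positive constants κ₀, δ₀, and O(1), where d(x₁,…,y_m) denotes a length
of the shortest graph connecting the points x₁,…,y_m."*  p. 624 [PDF 22]: *"We take K such that L^Kε ≦ ε₀, but L^{K+1}ε > ε₀ … We use Proposition 3.1
for this expansion and we get Z^ε ≧ ∫dA∫dφ χ_K(A)χ_K(φ)Z_KZ_K(0) exp[−½⟨A,Δ^{(K),L^Kε}A⟩ − ½⟨φ,Δ^{(K),L^Kε}(0)φ⟩ + V^{(K)ε}(0,0;A,φ) − E₀ + O(1)|T_ε|].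
(3.66)"*  p. 625 [PDF 23]: the sentence quoted in the title.  p. 607 [PDF 5]: *"φ(x) = (η/δ)^{−(d−2)/2}φ′(δx/η), x ∈ ηℤ^d (1.22) and the same formulas
for vector fields"* (here `η = L^Kε`, `δ = 1`: the unit-lattice fields `φ′ = (L^Kε)^{(d−2)/2}φ`, `A′ = (L^Kε)^{(d−2)/2}A` of `T₁^{(K)}`); (1.21): `|T₁^{(K)}|` =
the number of points of `T^{(K)}`, `|T_ε| = (L^Kε)^d|T₁^{(K)}|`.

THE ARGUMENT (the print's one sentence, made explicit).  At `k = K` with `B^{(K+1)} = 0`, `ψ = 0` the kernels of (3.57) are constants; on the support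
of `χ_K(A)χ_K(φ)` the unit-lattice components obey `|φ′_j(x)|, |A′_μ(y)| ≦ c·p_K` (file 2, `c = (a(1−L⁻²))⁻¹(1 + μ₀² + m²) + 1` dominating both
printed constants of (3.52)); the kernels obey (3.58), hence the weaker diameter bound `|v| ≦ O(1)(L^Kε)^{κ₀}e^{−δ₀diam}`; file 1 sums:
`|V^{(K),ε}(0,0;A,φ)| ≦ O(1)(L^Kε)^{κ₀}·|T₁^{(K)}|·Σ_{q≦q̄}((N+d)cp_K)^q·treeConst_q`.  Under the stopping rule `ε₀/L < L^Kε ≦ ε₀ ≦ 1`: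
`(L^Kε)^{κ₀} ≦ 1`, `|T₁^{(K)}| = (L^Kε)^{−d}|T_ε| ≦ (L/ε₀)^d|T_ε|`, `p_K ≦ p̄` (for the printed `p_K = p(L^Kε)`: `p̄ = p(ε₀/L)`, `pFn_mesh_le_of_stop`), so
`|V^{(K),ε}| ≦ C₂|T_ε|` with `C₂ = O(1)·(L/ε₀)^d·Σ_{q≦q̄}((N+d)cp̄)^q·treeConst_q` — INDEPENDENT of `ε` (*"thus on ε₀"*, p. 625).

WHAT THIS FILE PROVES (kernel-checked, zero `sorry`; axioms standard).
* §1 `Leg` (leg labels `{1..N} ⊔ {1..d}`), `legVal` (the unit-lattice components `φ′_j(y)`, `A′_μ(y)` of (1.22) at `η = L^Kε`), `abs_legVal_le`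
  (`≦ c·p_K` on the support of `χ_K`, file 2), `fieldC` (the constant `c`), **`abs_V357_le`** — THE p. 625 SENTENCE FOR THE MODEL, per lattice:
  a polynomial (3.57) in `A′, φ′` with kernels `|v| ≦ C_v(L^Kε)^{κ₀}e^{−δ₀diam}` satisfies `|V| ≦ C_v(L^Kε)^{κ₀}·|T₁^{(K)}|·polyConst(q̄, N+d, c p_K, d, δ₀)`
  on the support of `χ_K(A)χ_K(φ)` (`1 ≦ K ≦ K_P`, `L^Kε ≦ 1`).
* §2 `pFn_mesh_le_of_stop`, `card_site_le_of_stop` (`|T₁^{(K)}| ≦ (L/ε₀)^d|T_ε|`), the ε-free `c2Unif` and **`abs_V357_le_unif`**: `|V| ≦ c2Unif·|T_ε|`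
  under the stopping rule with `p_K ≦ p̄`, `ε₀ ≦ 1`.
* §3 the ledger: `Consts357` (the constants of Prop. 3.2 chosen before the lattice: degree bound `q̄`, `κ₀`, `δ₀`, `O(1)`, and `p̄`), **`PreInputs357`** =
  `B1Eq369Model.PreInputs369` WITHOUT `hE2`, WITH the printed data of Prop. 3.2 at `k = K` (kernels `coef`, the representation `hV` = (3.57) for
  `V^{(K),ε}(0,0;·,·)`, the bounds `h358`) and the threshold bookkeeping `hℓK : ℓ_K = L^Kε`, `hpK : 0 ≦ p_K ≦ p̄`; **`PreInputs357.toPreInputs369`**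
  (`hE2` DISCHARGED, given `C₂ ≧ c2Unif`); `lowerBound_lattice_of_preInputs357`; **`lowerBoundWith_cutoffFamilyStop_of_preInputs357`** /
  `lowerBoundPrinted_cutoffFamilyStop_of_preInputs357`: the lower half of (1.14) on the stopping sub-family with ONE constant `E₋ = U.eMinus D`, the
  remaining displayed inputs being `h360` ((3.26) step), `hE1` (Prop. 3.1 at `k = K`), the Prop. 3.2 data (3.57)/(3.58) at `k = K`, and `hE3`.
HONEST SCOPE.  Proposition 3.2 itself (the bounds (3.58) for the kernels the expansion produces) is NOT proved here or anywhere in paper I (*"A proof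
of this theorem will be given together with the proofs of the other properties of the perturbation expansions"*, p. 623 — paper III); it is DISPLAYED,
at `k = K`, `B = ψ = 0`, as the fields `coef`/`hV`/`h358` of `PreInputs357`, with the diameter in place of the Steiner length `d(…)` (weaker, implied by
the print since `d ≧ diam`) and re-indexed by total degree (file 1).  What IS proved is the sentence of p. 625 deriving `|V^{(K),ε}| ≦ O(1)|T_ε|` from it.
`1 ≦ K` (stopping sub-family `HasStop`), `ε₀ ≦ 1`, `m², μ₀² > 0`, `a > 0`, `L > 1` as in gen 11.  Nothing here is summit progress.
-/

open scoped BigOperators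
open _root_.MeasureTheory

namespace Literature.MathematicalPhysics.QuantumFieldTheory.Balaban1983to89.B1Prop32InteractionBound

open Literature.MathematicalPhysics.QuantumFieldTheory.Balaban1983to89.HiggsLattice (ChargeData action)
open Literature.MathematicalPhysics.QuantumFieldTheory.Balaban1983to89.HiggsDoubleRT (doubleRTk)
open Literature.MathematicalPhysics.QuantumFieldTheory.Balaban1983to89.B1Eq31Concrete (thrF)
open Literature.MathematicalPhysics.QuantumFieldTheory.Balaban1983to89.B1Ineq326HiggsModel (chiW extW)
open Literature.MathematicalPhysics.QuantumFieldTheory.Balaban1983to89.B1Ineq368BoxBound (smallSet)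
open Literature.MathematicalPhysics.QuantumFieldTheory.Balaban1983to89.B1LowerBound114Model (couplings mesh_gt_of_stop volT_nonneg)
open Literature.MathematicalPhysics.QuantumFieldTheory.Balaban1983to89.B1Sect1Statements (ModelData volT)
open Literature.MathematicalPhysics.QuantumFieldTheory.Balaban1983to89.B1Eq331Model (zVec zScal)
open Literature.MathematicalPhysics.QuantumFieldTheory.Balaban1983to89.B1Ineq368QuadForms (qVec qScal c5Unif)
open Literature.MathematicalPhysics.QuantumFieldTheory.Balaban1983to89.B1Eq369Model (PreInputs369 card_site_eq_vol c6Unif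
  lowerBound_lattice_of_preInputs369 HasStop cutoffFamilyStop)
open Literature.MathematicalPhysics.QuantumFieldTheory.Balaban1983to89.B1Ineq358TreeDecaySum (diam poly357 polyConst abs_poly357_le polyConst_nonneg)
open Literature.MathematicalPhysics.QuantumFieldTheory.Balaban1983to89.B1Ineq352LevelK (unit_field_bounds_of_chiW_ne_zero)
open Literature.MathematicalPhysics.QuantumFieldTheory.Balaban1983to89.B1Ineq352Proof (pFn_anti)

variable {P : HiggsLattice.Params} {N : ℕ}

/-! ## §1 The p. 625 sentence for the model, per lattice -/

section PerLattice

/-- The labels of the field components entering the monomials of (3.57): a scalar component `j ∈ {1,…,N}` (`φ′_j`) or a vector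
component `μ ∈ {1,…,d}` (`A′_μ`). [cite: Balaban1982Higgs1, Prop. 3.2 (3.57) p.622] -/
abbrev Leg (N d : ℕ) : Type := Fin N ⊕ Fin d

/-- **The arguments of (3.57) at `k = K`**: the unit-lattice components `φ′_j(y) = (L^Kε)^{(d−2)/2}φ_j(y)`, `A′_μ(y) = (L^Kε)^{(d−2)/2}A_μ(y)` of the
level-`K` fields ((1.22) p. 607 with `η = L^Kε`, `δ = 1`; in (3.66) `V^{(K)ε}(0,0;A,φ)` is `V^{(K)}` of (3.57) at `B^{(K+1)} = 0`, `ψ = 0` in these variables).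
[cite: Balaban1982Higgs1, Prop. 3.2 (3.57) p.622; (1.22) p.607; (3.66) p.624] -/
noncomputable def legVal (K : ℕ) (A : HiggsLattice.VecField P K) (φ : HiggsLattice.ScalarField P K N) :
    Leg N P.d → HiggsLattice.Site P K → ℝ
  | Sum.inl j, y => P.mesh K ^ (((P.d : ℝ) - 2) / 2) * φ y j
  | Sum.inr μ, y => P.mesh K ^ (((P.d : ℝ) - 2) / 2) * A ⟨y, μ⟩

/-- The `K, ε`-free field constant `c = (a(1−L⁻²))⁻¹(1 + μ₀² + m²) + 1`, dominating both constants of (3.52) at level `K` (file 2: `(a(1−L⁻²))⁻¹(1 + μ₀²) + 1`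
for `A`, `(a(1−L⁻²))⁻¹(1 + m²) + 1` for `φ`). [cite: Balaban1982Higgs1, (3.52) p.621; (2.15) p.609] -/
noncomputable def fieldC (L : ℕ) (a mu0sq msq : ℝ) : ℝ :=
  (a * (1 - ((L : ℝ) ^ 2)⁻¹))⁻¹ * (1 + mu0sq + msq) + 1

/-- `c ≧ 0` (indeed `≧ 1`) for `a > 0`, `L > 1`, `μ₀², m² ≧ 0`. [cite: Balaban1982Higgs1, (3.52) p.621] -/
theorem fieldC_nonneg {L : ℕ} (hL : 1 < (L : ℝ)) {a mu0sq msq : ℝ} (ha : 0 < a) (hmu : 0 ≤ mu0sq) (hmsq : 0 ≤ msq) :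
    0 ≤ fieldC L a mu0sq msq := by
  unfold fieldC
  have hainf : 0 < a * (1 - ((L : ℝ) ^ 2)⁻¹) := by
    have : ((L : ℝ) ^ 2)⁻¹ < 1 := inv_lt_one_of_one_lt₀ (by nlinarith)
    exact mul_pos ha (by linarith)
  have := inv_nonneg.2 hainf.le
  positivity

/-- **"the restrictions on the fields A, φ"**: on the support of `χ_K(A)χ_K(φ)` every argument of (3.57) obeys `|φ′_j(y)|, |A′_μ(y)| ≦ c·p_K`
(file 2 `unit_field_bounds_of_chiW_ne_zero`, both constants dominated by `fieldC`; `1 ≦ K ≦ K_P`, `L^Kε ≦ 1`, `p_K ≧ 0`, thresholds `ℓ_K = L^Kε`).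
[cite: Balaban1982Higgs1, p.625 (after (3.66)); (3.52) p.621] -/
theorem abs_legVal_le (C : ChargeData N) (ℓ p : ℕ → ℝ) {K : ℕ} (hK1 : 1 ≤ K) (hK : K ≤ P.K) {a mu0sq msq : ℝ} (ha : 0 < a)
    (hL : 1 < (P.L : ℝ)) (hmu : 0 < mu0sq) (hmsq : 0 < msq) (hℓK : ℓ K = P.mesh K) (hℓ1 : P.mesh K ≤ 1) (hp : 0 ≤ p K)
    {A : HiggsLattice.VecField P K} {φ : HiggsLattice.ScalarField P K N} (h : chiW C ℓ p mu0sq msq a K A φ ≠ 0) :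
    ∀ (l : Leg N P.d) (y : HiggsLattice.Site P K), |legVal K A φ l y| ≤ fieldC P.L a mu0sq msq * p K := by
  obtain ⟨hA, hφ⟩ := unit_field_bounds_of_chiW_ne_zero C ℓ p hK1 hK ha hL hmu hmsq hℓK hℓ1 hp h
  have hainf : 0 < a * (1 - ((P.L : ℝ) ^ 2)⁻¹) := by
    have : ((P.L : ℝ) ^ 2)⁻¹ < 1 := inv_lt_one_of_one_lt₀ (by nlinarith)
    exact mul_pos ha (by linarith)
  have hi := inv_nonneg.2 hainf.le
  have hcA : (a * (1 - ((P.L : ℝ) ^ 2)⁻¹))⁻¹ * (1 + mu0sq) + 1 ≤ fieldC P.L a mu0sq msq := by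
    unfold fieldC; nlinarith
  have hcφ : (a * (1 - ((P.L : ℝ) ^ 2)⁻¹))⁻¹ * (1 + msq) + 1 ≤ fieldC P.L a mu0sq msq := by
    unfold fieldC; nlinarith
  rintro (j | μ) y
  · exact (hφ y j).trans (mul_le_mul_of_nonneg_right hcφ hp)
  · exact (hA y μ).trans (mul_le_mul_of_nonneg_right hcA hp)

/-- The number of leg labels is `N + d`. [cite: Balaban1982Higgs1, Prop. 3.2 (3.57) p.622] -/
theorem card_leg (N d : ℕ) : Fintype.card (Leg N d) = N + d := by
  rw [Fintype.card_sum, Fintype.card_fin, Fintype.card_fin]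

/-- **THE p. 625 SENTENCE FOR THE (Higgs)₂,₃ MODEL, per lattice** — *"Using representation (3.57) in Proposition 3.2 and the restrictions on the fields
A, φ we can estimate the absolute value of the interaction V^{(K)ε} by O(1)(L^Kε)^{κ₀}|T₁^{(K)}|"*: if `V^{(K),ε}(0,0;A,φ) = Σ_{q≦q̄}Σ_{z}Σ_{κ} v(q;z;κ)Π_iz′`
(the shape (3.57) in the unit-lattice components `legVal`) with `|v(q;z;κ)| ≦ C_v(L^Kε)^{κ₀}e^{−δ₀·diam z}` (implied by (3.58)), then on the support of
`χ_K(A)χ_K(φ)`: `|V^{(K),ε}(0,0;A,φ)| ≦ C_v(L^Kε)^{κ₀}·|T₁^{(K)}|·polyConst(q̄, N+d, c·p_K, d, δ₀)` — the `O(1)` explicit (`1 ≦ K ≦ K_P`, `L^Kε ≦ 1`).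
[cite: Balaban1982Higgs1, p.625 (after (3.66)); Prop. 3.2 (3.57)–(3.58) p.622] -/
theorem abs_V357_le (C : ChargeData N) (ℓ p : ℕ → ℝ) {K : ℕ} (hK1 : 1 ≤ K) (hK : K ≤ P.K) {a mu0sq msq : ℝ} (ha : 0 < a)
    (hL : 1 < (P.L : ℝ)) (hmu : 0 < mu0sq) (hmsq : 0 < msq) (hℓK : ℓ K = P.mesh K) (hℓ1 : P.mesh K ≤ 1) (hp : 0 ≤ p K)
    {qmax : ℕ} (coef : (q : ℕ) → (Fin q → HiggsLattice.Site P K) → (Fin q → Leg N P.d) → ℝ) {Cv κ₀ δ₀ : ℝ} (hCv : 0 ≤ Cv)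
    (hδ₀ : 0 < δ₀) (h358 : ∀ q, q ≤ qmax → ∀ (z : Fin q → HiggsLattice.Site P K) (κ : Fin q → Leg N P.d),
      |coef q z κ| ≤ Cv * P.mesh K ^ κ₀ * Real.exp (-(δ₀ * (diam z : ℝ))))
    {A : HiggsLattice.VecField P K} {φ : HiggsLattice.ScalarField P K N} (h : chiW C ℓ p mu0sq msq a K A φ ≠ 0) :
    |poly357 qmax coef (legVal K A φ)|
      ≤ Cv * P.mesh K ^ κ₀ * (Fintype.card (HiggsLattice.Site P K) : ℝ) * polyConst qmax (N + P.d) (fieldC P.L a mu0sq msq * p K) P.d δ₀ := by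
  have hA₀ : 0 ≤ Cv * P.mesh K ^ κ₀ := mul_nonneg hCv (Real.rpow_nonneg (P.mesh_pos K).le _)
  have hq₀ : 0 ≤ fieldC P.L a mu0sq msq * p K := mul_nonneg (fieldC_nonneg hL ha hmu.le hmsq.le) hp
  have hb := abs_poly357_le qmax coef (legVal K A φ) hA₀ hδ₀ hq₀ h358 (abs_legVal_le C ℓ p hK1 hK ha hL hmu hmsq hℓK hℓ1 hp h)
  rw [card_leg] at hb
  push_cast at hb
  exact hb

end PerLattice

/-! ## §2 *"thus on ε₀"*: the ε-independent constant under the stopping rule -/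

section Uniform

/-- For the printed thresholds `p_K = p(L^Kε) = b₀(1 + log(L^Kε)⁻¹)^p` ((3.1) p. 613) the stopping rule `ε₀/L < L^Kε ≦ 1` gives the uniform bound
`p(L^Kε) ≦ p(ε₀/L)` (`p` is antitone on `(0,1]`, `B1Ineq352Proof.pFn_anti`; `b₀, p ≧ 0`, `L > 0`, `ε₀ > 0`) — an admissible `p̄` for `Consts357`.
[cite: Balaban1982Higgs1, (3.52) p.621; p.624 (before (3.66)); (3.1) p.613] -/
theorem pFn_mesh_le_of_stop {b₀ pe ε₀ : ℝ} (hb₀ : 0 ≤ b₀) (hpe : 0 ≤ pe) (hε₀ : 0 < ε₀) {K : ℕ} (hstop : ε₀ < P.mesh (K + 1))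
    (hℓ1 : P.mesh K ≤ 1) : B2.pFn b₀ pe (P.mesh K) ≤ B2.pFn b₀ pe (ε₀ / P.L) :=
  pFn_anti hb₀ hpe (div_pos hε₀ (by exact_mod_cast P.hL)) (mesh_gt_of_stop (P := P) hstop).le hℓ1

/-- **`|T₁^{(K)}| ≦ (L/ε₀)^d·|T_ε|`** under the stopping rule: `|T₁^{(K)}| = (L^Kε)^{−d}|T_ε|` ((1.21)) and `ε₀/L < L^Kε` (p. 624; `K ≦ K_P`, `ε₀ > 0`).
[cite: Balaban1982Higgs1, (1.21) p.607; p.624 (before (3.66))] -/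
theorem card_site_le_of_stop {ε₀ : ℝ} (hε₀ : 0 < ε₀) {K : ℕ} (hK : K ≤ P.K) (hstop : ε₀ < P.mesh (K + 1)) :
    (Fintype.card (HiggsLattice.Site P K) : ℝ) ≤ ((P.L : ℝ) / ε₀) ^ P.d * P.vol 0 Finset.univ := by
  rw [card_site_eq_vol (P := P) hK]
  have hm := mesh_gt_of_stop (P := P) hstop
  have hLpos : (0 : ℝ) < P.L := by exact_mod_cast P.hL
  have hinvd : (P.mesh K ^ P.d)⁻¹ ≤ ((P.L : ℝ) / ε₀) ^ P.d := by
    rw [← inv_pow, ← inv_div]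
    exact pow_le_pow_left₀ (inv_nonneg.2 (P.mesh_pos K).le) ((inv_le_inv₀ (P.mesh_pos K) (div_pos hε₀ hLpos)).2 hm.le) _
  exact mul_le_mul_of_nonneg_right hinvd (volT_nonneg P)

/-- **The ε-INDEPENDENT constant `C₂` of (E2)**: `c2Unif = C_v·(L/ε₀)^d·polyConst(q̄, N+d, c·p̄, d, δ₀)` with `c = fieldC L a μ₀² m²` — a function of the
model data and of the constants of Prop. 3.2 only (*"a constant O(1) which in general depends on L^Kε, thus on ε₀"*, p. 625).
[cite: Balaban1982Higgs1, p.625 (after (3.66)); Prop. 3.2 (3.58) p.622] -/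
noncomputable def c2Unif (d N L : ℕ) (a mu0sq msq ε₀ : ℝ) (qmax : ℕ) (Cv δ₀ pbar : ℝ) : ℝ :=
  Cv * ((L : ℝ) / ε₀) ^ d * polyConst qmax (N + d) (fieldC L a mu0sq msq * pbar) d δ₀

/-- **THE p. 625 SENTENCE WITH ITS ε-FREE CONSTANT**: under the stopping rule `L^Kε ≦ ε₀ < L^{K+1}ε` with `ε₀ ≦ 1`, `1 ≦ K ≦ K_P`, `κ₀ > 0`, thresholds
`ℓ_K = L^Kε`, `0 ≦ p_K ≦ p̄`, a polynomial (3.57) with kernels `|v| ≦ C_v(L^Kε)^{κ₀}e^{−δ₀diam}` satisfies `|V^{(K),ε}(0,0;A,φ)| ≦ c2Unif·|T_ε|` on the support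
of `χ_K(A)χ_K(φ)` — the input (E2) *"|V^{(K),ε}| ≦ C₂|T_ε|"* of the model's ledger with `C₂` independent of `ε`.
[cite: Balaban1982Higgs1, p.625 (after (3.66)); p.624 (before (3.66)); Prop. 3.2 (3.57)–(3.58) p.622] -/
theorem abs_V357_le_unif (C : ChargeData N) (ℓ p : ℕ → ℝ) {K : ℕ} (hK1 : 1 ≤ K) (hK : K ≤ P.K) {a mu0sq msq : ℝ} (ha : 0 < a)
    (hL : 1 < (P.L : ℝ)) (hmu : 0 < mu0sq) (hmsq : 0 < msq) (hℓK : ℓ K = P.mesh K) {ε₀ pbar : ℝ} (hε₀ : 0 < ε₀) (hε₀1 : ε₀ ≤ 1)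
    (hKε : P.mesh K ≤ ε₀) (hstop : ε₀ < P.mesh (K + 1)) (hp : 0 ≤ p K) (hpbar : p K ≤ pbar)
    {qmax : ℕ} (coef : (q : ℕ) → (Fin q → HiggsLattice.Site P K) → (Fin q → Leg N P.d) → ℝ) {Cv κ₀ δ₀ : ℝ} (hCv : 0 ≤ Cv) (hκ₀ : 0 < κ₀)
    (hδ₀ : 0 < δ₀) (h358 : ∀ q, q ≤ qmax → ∀ (z : Fin q → HiggsLattice.Site P K) (κ : Fin q → Leg N P.d),
      |coef q z κ| ≤ Cv * P.mesh K ^ κ₀ * Real.exp (-(δ₀ * (diam z : ℝ))))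
    {A : HiggsLattice.VecField P K} {φ : HiggsLattice.ScalarField P K N} (h : chiW C ℓ p mu0sq msq a K A φ ≠ 0) :
    |poly357 qmax coef (legVal K A φ)| ≤ c2Unif P.d N P.L a mu0sq msq ε₀ qmax Cv δ₀ pbar * P.vol 0 Finset.univ := by
  have hℓ1 : P.mesh K ≤ 1 := hKε.trans hε₀1
  have hc0 := fieldC_nonneg hL ha hmu.le hmsq.le
  -- bound the legs by the uniform `c·p̄`
  have hleg : ∀ (l : Leg N P.d) (y : HiggsLattice.Site P K), |legVal K A φ l y| ≤ fieldC P.L a mu0sq msq * pbar :=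
    fun l y => (abs_legVal_le C ℓ p hK1 hK ha hL hmu hmsq hℓK hℓ1 hp h l y).trans (mul_le_mul_of_nonneg_left hpbar hc0)
  have hA₀ : 0 ≤ Cv * P.mesh K ^ κ₀ := mul_nonneg hCv (Real.rpow_nonneg (P.mesh_pos K).le _)
  have hq₀ : 0 ≤ fieldC P.L a mu0sq msq * pbar := mul_nonneg hc0 (hp.trans hpbar)
  have hb := abs_poly357_le qmax coef (legVal K A φ) hA₀ hδ₀ hq₀ h358 hleg
  rw [card_leg] at hb
  push_cast at hb
  refine hb.trans ?_
  -- (L^Kε)^{κ₀} ≤ 1, |T₁^{(K)}| ≤ (L/ε₀)^d |T_ε|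
  have hpow : P.mesh K ^ κ₀ ≤ 1 := Real.rpow_le_one (P.mesh_pos K).le hℓ1 hκ₀.le
  have hcard := card_site_le_of_stop (P := P) hε₀ hK hstop
  have hpc : 0 ≤ polyConst qmax ((N : ℝ) + (P.d : ℝ)) (fieldC P.L a mu0sq msq * pbar) P.d δ₀ :=
    polyConst_nonneg qmax (mul_nonneg (by positivity) hq₀) P.d hδ₀.le
  unfold c2Unif
  have e1 : Cv * P.mesh K ^ κ₀ * (Fintype.card (HiggsLattice.Site P K) : ℝ) ≤ Cv * (((P.L : ℝ) / ε₀) ^ P.d * P.vol 0 Finset.univ) := by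
    calc Cv * P.mesh K ^ κ₀ * (Fintype.card (HiggsLattice.Site P K) : ℝ) ≤ Cv * 1 * (Fintype.card (HiggsLattice.Site P K) : ℝ) :=
          mul_le_mul_of_nonneg_right (mul_le_mul_of_nonneg_left hpow hCv) (Nat.cast_nonneg _)
      _ ≤ Cv * 1 * (((P.L : ℝ) / ε₀) ^ P.d * P.vol 0 Finset.univ) := mul_le_mul_of_nonneg_left hcard (by rw [mul_one]; exact hCv)
      _ = Cv * (((P.L : ℝ) / ε₀) ^ P.d * P.vol 0 Finset.univ) := by rw [mul_one]
  calc Cv * P.mesh K ^ κ₀ * (Fintype.card (HiggsLattice.Site P K) : ℝ) * polyConst qmax ((N : ℝ) + (P.d : ℝ)) (fieldC P.L a mu0sq msq * pbar) P.d δ₀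
      ≤ Cv * (((P.L : ℝ) / ε₀) ^ P.d * P.vol 0 Finset.univ) * polyConst qmax ((N : ℝ) + (P.d : ℝ)) (fieldC P.L a mu0sq msq * pbar) P.d δ₀ :=
        mul_le_mul_of_nonneg_right e1 hpc
    _ = Cv * ((P.L : ℝ) / ε₀) ^ P.d * polyConst qmax ((N : ℝ) + (P.d : ℝ)) (fieldC P.L a mu0sq msq * pbar) P.d δ₀ * P.vol 0 Finset.univ := by
        ring

end Uniform

/-! ## §3 The model's ledger of (1.14) with `hE2` discharged from the printed data of Proposition 3.2 -/

section Ledger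

/-- **The constants of Proposition 3.2 chosen before the lattice** (*"for some independent of k positive constants κ₀, δ₀, and O(1)"*, p. 622; the degree
bound `n(n̄)` of (3.57), here the total-degree bound `q̄`; and a uniform bound `p̄` of the threshold values `p_K`, e.g. `p(ε₀/L)` for the printed
`p_K = p(L^Kε)`, `pFn_mesh_le_of_stop`). [cite: Balaban1982Higgs1, Prop. 3.2 (3.57)–(3.58) p.622; (3.52) p.621] -/
structure Consts357 where
  qmax : ℕ
  κ₀ : ℝ
  δ₀ : ℝ
  Cv : ℝ
  pbar : ℝ
  hκ₀ : 0 < κ₀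
  hδ₀ : 0 < δ₀
  hCv : 0 ≤ Cv

/-- **The displayed inputs of Sects. 2–3 on ONE lattice with the PRINTED DATA OF PROPOSITION 3.2 in place of (E2)**: `B1Eq369Model.PreInputs369` (a stopping
scale `1 ≦ K ≦ K_P`, thresholds, effective actions, the (3.26) step bound `h360`, (E1) of Prop. 3.1 for the model's own normalisations and forms, (E3)) WITHOUT
`hE2`, WITH: the kernels `coef` of the representation (3.57) of `V^{(K),ε}(0,0;A,φ)` at `k = K`, `B^{(K+1)} = 0`, `ψ = 0` in the unit-lattice components
((1.22)), the representation itself `hV`, the bounds (3.58) `h358` (`|v| ≦ O(1)(L^Kε)^{κ₀}e^{−δ₀diam}`, the diameter replacing the printed Steiner length —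
weaker), and the threshold bookkeeping `ℓ_K = L^Kε` ((3.27)), `0 ≦ p_K ≦ p̄`. [cite: Balaban1982Higgs1, Prop. 3.2 (3.57)–(3.58) p.622; (3.66) p.624; (3.26)–(3.29) p.617] -/
structure PreInputs357 (D : ModelData) (U : B1LowerBound114Model.Consts) (W : Consts357) (P : HiggsLattice.Params) where
  K : ℕ
  hK1 : 1 ≤ K
  hKP : K ≤ P.K
  hKε : P.mesh K ≤ U.ε₀
  hstop : U.ε₀ < P.mesh (K + 1)
  ℓ : ℕ → ℝ
  p : ℕ → ℝ
  hℓK : ℓ K = P.mesh K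
  hpK : 0 ≤ p K ∧ p K ≤ W.pbar
  S : (k : ℕ) → HiggsLattice.VecField P k → HiggsLattice.ScalarField P k D.N → ℝ
  h0 : S 0 = action D.C (couplings D P)
  hS : ∀ k, k ≤ K → Integrable fun Φ : HiggsLattice.VecField P k × HiggsLattice.ScalarField P k D.N => Real.exp (-S k Φ.1 Φ.2)
  h360 : ∀ k, k < K → ∀ (B : HiggsLattice.VecField P (k + 1)) (ψ : HiggsLattice.ScalarField P (k + 1) D.N),
    chiW D.C ℓ p D.mu0sq D.msq U.a (k + 1) B ψ ≠ 0 →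
      Real.exp (-S (k + 1) B ψ) * Real.exp (-(U.Cst * P.mesh k ^ U.κ₀ * P.vol 0 Finset.univ))
        ≤ doubleRTk D.C U.a (extW D.mu0sq U.a k) (fun A φ => chiW D.C ℓ p D.mu0sq D.msq U.a k A φ * Real.exp (-S k A φ)) B ψ
  V : HiggsLattice.VecField P K × HiggsLattice.ScalarField P K D.N → ℝ
  coef : (q : ℕ) → (Fin q → HiggsLattice.Site P K) → (Fin q → Leg D.N P.d) → ℝ
  hV : ∀ ω : HiggsLattice.VecField P K × HiggsLattice.ScalarField P K D.N, V ω = poly357 W.qmax coef (legVal K ω.1 ω.2)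
  h358 : ∀ q, q ≤ W.qmax → ∀ (z : Fin q → HiggsLattice.Site P K) (κ : Fin q → Leg D.N P.d),
    |coef q z κ| ≤ W.Cv * P.mesh K ^ W.κ₀ * Real.exp (-(W.δ₀ * (diam z : ℝ)))
  hE1 : ∀ ω : HiggsLattice.VecField P K × HiggsLattice.ScalarField P K D.N, chiW D.C ℓ p D.mu0sq D.msq U.a K ω.1 ω.2 ≠ 0 →
    zVec P D.mu0sq U.a K * zScal P D.C D.msq U.a K
        * Real.exp (-(qVec P D.mu0sq U.a K ω.1) / 2 - qScal D.C D.msq U.a K ω.2 / 2 + V ω - D.e0 P - U.C₁ * P.vol 0 Finset.univ)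
      ≤ Real.exp (-S K ω.1 ω.2)
  hE3 : ∀ ω ∈ smallSet P D.N K U.r₀, chiW D.C ℓ p D.mu0sq D.msq U.a K ω.1 ω.2 = 1

/-- **`hE2` DISCHARGED**: on a lattice with the model's `d, L`, the pre-inputs with the Prop. 3.2 data give gen 11's `PreInputs369` with (E2) *"|V^{(K),ε}| ≦ C₂|T_ε|"*
PROVED on the support of `χ_K` (`abs_V357_le_unif`), provided `C₂ ≧ c2Unif(d, N, L, a, μ₀², m², ε₀; q̄, O(1), δ₀, p̄)` and `ε₀ ≦ 1` (`m², μ₀² > 0`, `L > 1`).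
[cite: Balaban1982Higgs1, p.625 (after (3.66)); Theorem (1.14) p.606] -/
noncomputable def PreInputs357.toPreInputs369 {D : ModelData} {U : B1LowerBound114Model.Consts} {W : Consts357} {P : HiggsLattice.Params}
    (X : PreInputs357 D U W P) (hm : 0 < D.msq) (hmu : 0 < D.mu0sq) (hPd : P.d = D.d) (hPL : P.L = D.L) (hL : 1 < D.L) (hε₀1 : U.ε₀ ≤ 1)
    (hC2 : c2Unif D.d D.N D.L U.a D.mu0sq D.msq U.ε₀ W.qmax W.Cv W.δ₀ W.pbar ≤ U.C₂) : PreInputs369 D U P :=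
  { K := X.K, hK1 := X.hK1, hKP := X.hKP, hKε := X.hKε, hstop := X.hstop, ℓ := X.ℓ, p := X.p, S := X.S, h0 := X.h0, hS := X.hS,
    h360 := X.h360, V := X.V, hE1 := X.hE1, hE3 := X.hE3,
    hE2 := by
      rintro ⟨A, φ⟩ hχ
      have hL' : 1 < (P.L : ℝ) := by
        rw [hPL]
        exact_mod_cast hL
      have h := abs_V357_le_unif D.C X.ℓ X.p X.hK1 X.hKP U.ha hL' hmu hm X.hℓK U.hε₀ hε₀1 X.hKε X.hstop X.hpK.1 X.hpK.2
        X.coef W.hCv W.hκ₀ W.hδ₀ X.h358 hχ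
      rw [← X.hV (A, φ)] at h
      rw [← hPd, ← hPL] at hC2
      exact h.trans (mul_le_mul_of_nonneg_right hC2 (volT_nonneg P)) }

/-- **Per lattice**: the pre-inputs with the Prop. 3.2 data on an admissible lattice give `exp(−E₋|T_ε|) ≦ Z^ε` with the ε-independent `E₋ = U.eMinus D =
C₁ + C₂ + C·ε₀^{κ₀}/(L^{κ₀} − 1) + C₄(ε₀/L, r₀) + C₅ + C₆` (gen 11's `lowerBound_lattice_of_preInputs369`, given `C₅ ≧ c5Unif`, `C₆ ≧ c6Unif`, `C₂ ≧ c2Unif`).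
[cite: Balaban1982Higgs1, Theorem (1.14) p.606; (3.66)–(3.69) pp.624–625] -/
theorem lowerBound_lattice_of_preInputs357 (D : ModelData) (hm : 0 < D.msq) (hmu : 0 < D.mu0sq) (hL : 1 < D.L)
    (U : B1LowerBound114Model.Consts) (W : Consts357) (hε₀1 : U.ε₀ ≤ 1) (hC2 : c2Unif D.d D.N D.L U.a D.mu0sq D.msq U.ε₀ W.qmax W.Cv W.δ₀ W.pbar ≤ U.C₂)
    (hC5 : c5Unif D.d D.L U.a D.mu0sq D.msq U.ε₀ U.r₀ ≤ U.C₅) (hC6 : c6Unif D.d D.N D.L U.a D.mu0sq D.msq U.ε₀ ≤ U.C₆)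
    {P : HiggsLattice.Params} (hP : D.Admissible P) (X : PreInputs357 D U W P) :
    Real.exp (-(U.eMinus D * volT P)) ≤ D.zRen P :=
  lowerBound_lattice_of_preInputs369 D hm hmu hL U hε₀1 hC5 hC6 hP (X.toPreInputs369 hm hmu hP.1 hP.2.1 hL hε₀1 hC2)

/-- **Theorem (1.14), lower half, FOR THE MODEL on the stopping sub-family, from the pre-inputs with the printed data of Proposition 3.2**: if every admissible
lattice admitting a stopping scale carries `PreInputs357` (constants `U`, `W` chosen before the lattice, `C₂ ≧ c2Unif`, `C₅ ≧ c5Unif`, `C₆ ≧ c6Unif`, `ε₀ ≦ 1`), then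
`exp(−E₋|T_ε|) ≦ Z^ε` on the whole sub-family `B1Eq369Model.cutoffFamilyStop` with ONE constant `E₋ = U.eMinus D` — the remaining displayed inputs being
`h360`, `hE1`, the Prop. 3.2 data at `k = K`, and `hE3`. [cite: Balaban1982Higgs1, Theorem (1.14) p.606; (3.66)–(3.69) pp.624–625; Prop. 3.2 p.622] -/
theorem lowerBoundWith_cutoffFamilyStop_of_preInputs357 (D : ModelData) (hm : 0 < D.msq) (hmu : 0 < D.mu0sq) (hL : 1 < D.L)
    (U : B1LowerBound114Model.Consts) (W : Consts357) (hε₀1 : U.ε₀ ≤ 1)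
    (hC2 : c2Unif D.d D.N D.L U.a D.mu0sq D.msq U.ε₀ W.qmax W.Cv W.δ₀ W.pbar ≤ U.C₂)
    (hC5 : c5Unif D.d D.L U.a D.mu0sq D.msq U.ε₀ U.r₀ ≤ U.C₅) (hC6 : c6Unif D.d D.N D.L U.a D.mu0sq D.msq U.ε₀ ≤ U.C₆)
    (h : ∀ P : HiggsLattice.Params, D.Admissible P → HasStop P U.ε₀ → Nonempty (PreInputs357 D U W P)) :
    B1LowerBound.LowerBoundWith (cutoffFamilyStop D U.ε₀) (U.eMinus D) := by
  intro i
  obtain ⟨X⟩ := h i.1 i.2.1 i.2.2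
  exact lowerBound_lattice_of_preInputs357 D hm hmu hL U W hε₀1 hC2 hC5 hC6 i.2.1 X

/-- *"there exist the constant E₋ independent of ε, T_ε"* with `exp(−E₋|T_ε|) ≦ Z^ε` on the stopping sub-family — r14's `B1LowerBound.LowerBoundPrinted` —
from the pre-inputs with the Prop. 3.2 data. [cite: Balaban1982Higgs1, Theorem (1.14) p.606] -/
theorem lowerBoundPrinted_cutoffFamilyStop_of_preInputs357 (D : ModelData) (hm : 0 < D.msq) (hmu : 0 < D.mu0sq) (hL : 1 < D.L)
    (U : B1LowerBound114Model.Consts) (W : Consts357) (hε₀1 : U.ε₀ ≤ 1)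
    (hC2 : c2Unif D.d D.N D.L U.a D.mu0sq D.msq U.ε₀ W.qmax W.Cv W.δ₀ W.pbar ≤ U.C₂)
    (hC5 : c5Unif D.d D.L U.a D.mu0sq D.msq U.ε₀ U.r₀ ≤ U.C₅) (hC6 : c6Unif D.d D.N D.L U.a D.mu0sq D.msq U.ε₀ ≤ U.C₆)
    (h : ∀ P : HiggsLattice.Params, D.Admissible P → HasStop P U.ε₀ → Nonempty (PreInputs357 D U W P)) :
    B1LowerBound.LowerBoundPrinted (cutoffFamilyStop D U.ε₀) :=
  ⟨U.eMinus D, lowerBoundWith_cutoffFamilyStop_of_preInputs357 D hm hmu hL U W hε₀1 hC2 hC5 hC6 h⟩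

end Ledger

end Literature.MathematicalPhysics.QuantumFieldTheory.Balaban1983to89.B1Prop32InteractionBound
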